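import Summits.RiemannHypothesis.RiemannHypothesis.Theorems.EvenSectorBartaEvenOneSignedWindowsAMPMargin
import HarnessLib

/-!
# PF persistence — THE ODD-LEVEL WALL ON THE AMP THRESHOLD: the Galerkin intertwining identity (G) and
# `s* ≤ ε₁⁻` from three served signs

pub-rhpf PF seat (gen 4). Helper file (`--supports stmt-RiemannHypothesis-19953`).
**HONEST FRAMING. Long-odds MECHANISM SEARCH; mechanism/rigidity campaign; no RH claims.** RH-free linear algebra
over an abstract real inner-product space; no `ζ` statement occurs; every statement below is PROVED; the
intertwining identity (G) is a HYPOTHESIS (an argument), never asserted.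

## Why this file
`PF.md` §14–§15 carries the DATA law of the anti-maximum-principle (AMP) margin of ζ's even window block,
`t* = (s* − ε₁⁺)/(E₁(A₀) − ε₁⁺)` (`ampMargin`, file `EvenSectorBartaEvenOneSignedWindowsAMPMargin`): the AMP
threshold sits a FIXED 2.2 % below the ODD-sector ground level, `s*/ε₁⁻ ∈ [0.973, 0.979]` at 10/10 points,
`a ∈ [1, 3]`, `N ∈ [40, 200]` (INVARIANT-CANDIDATES row PF-C1; `t* = (2.75 ± 0.15)·ε₁⁺/ε₁⁻`).  `pub-rhpf-cand-7`
(AMP-IDENTITY.md, 2026-08-19T10:10Z, DERIVED + DATA at 17 points) explained it by a KINEMATIC identity of the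
Connes basis of one window `[-a, a]` (even `ξ₀, ξₙ ∝ cos(πnx/a)`, odd `ξ₋ₙ ∝ sin(πnx/a)`, `D ξ₋ₙ = (πn/a) ξₙ`):
for the even/odd Galerkin blocks `Q⁺, Q⁻` of ONE windowed convolution form,

  (G)  `Q⁺ D − D Q⁻ = 2 · δ_a ρᵀ`  (rank one; `δ_a` = the projected edge delta, `ρ` = the edge-value functional),

DATA of this seat (gcheck.py on the 56-digit blocks of `pub-rhpf-fake-6/sectortables`, `N = 100`): the matrix
residual of (G) is `≤ 3.8e-54` relative at `a = 1.00` (kinematic, as it must be).  This file types (G) as the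
hypothesis `GalerkinIntertwining` and PROVES what follows from it for the AMP family
`x(s) = (A₀ − s)⁻¹ c` of the pole-free block `A₀` (`Q⁺ = A₀ + β|c⟩⟨c|`, `β = 2` for ζ, `c` = polar vector):

* `intertwining_pairing` — at an odd eigen-level `e` (`Q⁻ψ = eψ`), for any solution `A₀ x − e x = c`:
  `2 ρ(ψ) ⟪δ_a, x⟫ = ⟪c, Dψ⟫ (1 + β ⟪c, x⟫)` (the edge value of the AMP vector at the odd level, in served
  numbers); `edge_pairing_eq`, and the EXACT COROLLARY `edge_pairing_eq_zero_iff`: the AMP edge value vanishes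
  AT the odd level iff `⟪c, Dψ⟫ = 0` (for the polar vector: iff `ψ ⊥ sinh(x/2)`, cand-7 §2);
* `intertwining_pairing_even_eigen` — cand-7's k-independence test `(ε⁺ − e)⟪φ, Dψ⟫ = 2ρ(ψ)⟪δ_a, φ⟫` for every
  even eigenpair `(ε⁺, φ)` of `Q⁺` (DATA: k-independent to 3e-17 … 4e-28 on ζ and on 10 control families);
* THE WALL `ampThreshold_le_of_edge_sign` — in the setting of `ampFailureLevels`/`ampThreshold`/`ampMargin`
  (evaluation family `ev`, floor `δ ≥ 0`, polar overlap `p`): if the edge evaluation `⟪δ_a, ·⟫` is one of the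
  evaluations and `p·⟪δ_a, x(e)⟫ ≥ 0` at a level `e ∈ [ε₁, E₁]`, then `e` is a failure level, so `s* ≤ e` and
  `t* ≤ (e − ε₁)/(E₁ − ε₁)` (`ampMargin_le_of_edge_sign`); with (G) the sign hypothesis becomes the sign of the
  product of THREE SERVED NUMBERS `p·⟪c, Dψ⟫·(1 + β⟪c, x⟫)·ρ(ψ)` (`ampThreshold_le_oddLevel`,
  `ampMargin_le_oddLevel`); in level units `(E₁ − ε₁⁺)·t* ≤ ε₁⁻ − ε₁⁺` (`gap_ge_ampMargin_mul`): the AMP margin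
  is AT MOST THE EVEN–ODD GAP measured in units of the pole-free window `E₁ − ε₁⁺`, and a positive margin (⟺ a
  one-signed even ground state, `ampMargin_pos_iff_oneSigned`) needs `ε₁⁺ < ε₁⁻` strictly
  (`oddLevel_gt_of_ampMargin_pos`, for an odd level inside `[ε₁⁺, E₁]`).

DATA (this seat, gcheck.py, ζ, `N = 100`, the 14 windows `a = 0.55, 0.60, …, 1.20` of fake-6's 56-digit blocks,
80-digit arithmetic; `e = ε₁⁻`, `ψ = ψ₁` the odd ground vector, `p = ⟪c, u⟫` with `u` the even pole-free ground
vector): (G) matrix residual `≤ 9.5e-54` relative at 14/14; pairing identity reproduced to relative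
`2e-44 … 6e-11` at 14/14 (input-precision limited: 56-digit blocks against levels down to `ε₁⁻ = 5e-45`); served
signs `p > 0`, `⟪c, Dψ₁⟫ < 0` (`= −½⟨sinh(x/2), ψ₁⟩`, odd ground one-signed on the half window), `1 + 2⟪c, x⟫ > 0`
(secular function above its zero `ε₁⁺`, i.e. even-below-odd), `ρ(ψ₁) < 0` at 14/14 ⇒ the sign condition holds
and THE WALL APPLIES AT 14/14: `s* ≤ ε₁⁻`.  Saturation `t*/wall = 0.9831, 0.9822, 0.9816, 0.9810, 0.9805, 0.9800,
0.9796, 0.9792, 0.9789, 0.9786, 0.9784, 0.9782, 0.9780, 0.9778` (monotone in `a`; `= s*/ε₁⁻` to 4 digits), e.g.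
`(1.00, 100)`: `p = 0.857`, `⟪c, Dψ₁⟫ = −6.33e-2`, `1 + 2⟪c, x⟫ = +1.10e-26`, `ρ(ψ₁) = −2.16e-12`, wall
`t* ≤ 1.0324e-3`, measured `t* = 1.0104e-3`.  So the PF-C1 law (`s*/ε₁⁻ ∈ [0.973, 0.979]`, `a ∈ [1, 3]`) is this
PROVED inequality, 97.8–98.3 % saturated; the residual 2 % is pole dominance (cand-7 §2), not typed here.  Nothing
here is RH-relevant on its own: (G) holds for every weight table; what is ζ-specific is only the three signs.

References: cand-7 AMP-IDENTITY.md §1–§2 (derivation of (G): `ψ(±a) = 0` ⇒ `(χψ)′ = χψ′`, integrate by parts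
against `ξₘχ`); Ph. Clément, L. A. Peletier, *An anti-maximum principle for second-order elliptic operators*,
J. Differential Equations 34 (1979) 218–229 (the AMP); G. H. Golub, C. F. Van Loan, *Matrix Computations*,
4th ed., Thm 8.4.3 (rank-one modification / secular equation).
-/

set_option linter.dupNamespace false

namespace Summit.RiemannHypothesis.RiemannHypothesis.Theorems.PolarPerronFrobenius

open scoped InnerProductSpace

variable {E : Type*} [NormedAddCommGroup E] [InnerProductSpace ℝ E]
variable {F : Type*} [AddCommGroup F] [Module ℝ F]
variable {ι : Type*}

/-! ## §1 The intertwining hypothesis (G) and the pairing identities -/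

/-- A HYPOTHESIS (posited identity, never asserted): the GALERKIN INTERTWINING IDENTITY (G) of one window,
`Q⁺ D − D Q⁻ = 2·δ_a ρᵀ` with `Q⁺ = A₀ + β|c⟩⟨c|` — here `A₀` is the even pole-free block, `c` the polar vector,
`d = δ_a` the projected edge delta, `D` the derivative map odd → even, `Qm = Q⁻` the odd block and `ρ` the
edge-value functional. (cand-7 AMP-IDENTITY.md §1; DATA: matrix residual ≤ 3.8e-54 relative, ζ, a = 1, N = 100.)
[folklore] -/
@[folklore]
def GalerkinIntertwining (A₀ : E →ₗ[ℝ] E) (c d : E) (β : ℝ) (D : F →ₗ[ℝ] E) (Qm : F →ₗ[ℝ] F)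
    (ρ : F →ₗ[ℝ] ℝ) : Prop :=
  ∀ y : F, A₀ (D y) + β • (⟪c, D y⟫_ℝ • c) - D (Qm y) = (2 * ρ y) • d

section pairing

variable {A₀ : E →ₗ[ℝ] E} {c d : E} {β : ℝ} {D : F →ₗ[ℝ] E} {Qm : F →ₗ[ℝ] F} {ρ : F →ₗ[ℝ] ℝ}

/-- **PROVED — THE PAIRING IDENTITY AT AN ODD LEVEL.** If `A₀` is symmetric, (G) holds, `Q⁻ψ = eψ` and
`A₀ x − e x = c` (the AMP vector at the odd level), then `2ρ(ψ)⟪δ_a, x⟫ = ⟪c, Dψ⟫(1 + β⟪c, x⟫)`. [folklore] -/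
theorem intertwining_pairing (hA : ∀ v w : E, ⟪A₀ v, w⟫_ℝ = ⟪v, A₀ w⟫_ℝ)
    (hG : GalerkinIntertwining A₀ c d β D Qm ρ) {e : ℝ} {ψ : F} (hψ : Qm ψ = e • ψ) {x : E}
    (hx : A₀ x - e • x = c) :
    2 * ρ ψ * ⟪d, x⟫_ℝ = ⟪c, D ψ⟫_ℝ * (1 + β * ⟪c, x⟫_ℝ) := by
  have h := hG ψ
  rw [hψ, map_smul] at h
  have hAx : A₀ x = e • x + c := by rw [← hx]; abel
  have key : ⟪A₀ (D ψ), x⟫_ℝ = e * ⟪D ψ, x⟫_ℝ + ⟪c, D ψ⟫_ℝ := by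
    rw [hA, hAx, inner_add_right, real_inner_smul_right, real_inner_comm c (D ψ)]
  have h2 := congrArg (fun v => ⟪v, x⟫_ℝ) h
  simp only [inner_sub_left, inner_add_left, real_inner_smul_left] at h2
  rw [key] at h2
  linear_combination (-1 : ℝ) * h2

/-- **PROVED — THE EDGE VALUE OF THE AMP VECTOR AT THE ODD LEVEL, in served numbers**:
`⟪δ_a, x⟫ = ⟪c, Dψ⟫(1 + β⟪c, x⟫)/(2ρ(ψ))` when `ρ(ψ) ≠ 0`. [folklore] -/
theorem edge_pairing_eq (hA : ∀ v w : E, ⟪A₀ v, w⟫_ℝ = ⟪v, A₀ w⟫_ℝ)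
    (hG : GalerkinIntertwining A₀ c d β D Qm ρ) {e : ℝ} {ψ : F} (hψ : Qm ψ = e • ψ) {x : E}
    (hx : A₀ x - e • x = c) (hρ : ρ ψ ≠ 0) :
    ⟪d, x⟫_ℝ = ⟪c, D ψ⟫_ℝ * (1 + β * ⟪c, x⟫_ℝ) / (2 * ρ ψ) := by
  have h := intertwining_pairing hA hG hψ hx
  rw [eq_div_iff (mul_ne_zero two_ne_zero hρ), mul_comm]
  exact h

/-- **PROVED — EXACT COROLLARY (cand-7 §2).** With `ρ(ψ) ≠ 0` and off the secular zero (`1 + β⟪c, x⟫ ≠ 0`),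
the AMP edge value vanishes exactly at the odd level iff `⟪c, Dψ⟫ = 0` (for the polar vector `c = cosh(x/2)χ`:
iff the odd eigenvector is orthogonal to `sinh(x/2)`). [folklore] -/
theorem edge_pairing_eq_zero_iff (hA : ∀ v w : E, ⟪A₀ v, w⟫_ℝ = ⟪v, A₀ w⟫_ℝ)
    (hG : GalerkinIntertwining A₀ c d β D Qm ρ) {e : ℝ} {ψ : F} (hψ : Qm ψ = e • ψ) {x : E}
    (hx : A₀ x - e • x = c) (hρ : ρ ψ ≠ 0) (hsec : 1 + β * ⟪c, x⟫_ℝ ≠ 0) :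
    ⟪d, x⟫_ℝ = 0 ↔ ⟪c, D ψ⟫_ℝ = 0 := by
  have h := intertwining_pairing hA hG hψ hx
  constructor
  · intro h0
    rw [h0, mul_zero] at h
    exact (mul_eq_zero.mp h.symm).resolve_right hsec
  · intro h0
    rw [h0, zero_mul] at h
    rcases mul_eq_zero.mp h with h1 | h1
    · exact absurd h1 (mul_ne_zero two_ne_zero hρ)
    · exact h1

/-- **PROVED — SIGN TRANSFER.** The sign of `p·⟪δ_a, x⟫` is the sign of the product of the served numbers
`p·⟪c, Dψ⟫·(1 + β⟪c, x⟫)·ρ(ψ)` (`ρ(ψ) ≠ 0`). [folklore] -/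
theorem edge_sign_of_served (hA : ∀ v w : E, ⟪A₀ v, w⟫_ℝ = ⟪v, A₀ w⟫_ℝ)
    (hG : GalerkinIntertwining A₀ c d β D Qm ρ) {e : ℝ} {ψ : F} (hψ : Qm ψ = e • ψ) {x : E}
    (hx : A₀ x - e • x = c) (hρ : ρ ψ ≠ 0) {p : ℝ}
    (hs : 0 ≤ p * ⟪c, D ψ⟫_ℝ * (1 + β * ⟪c, x⟫_ℝ) * ρ ψ) : 0 ≤ p * ⟪d, x⟫_ℝ := by
  have hdx := edge_pairing_eq hA hG hψ hx hρ
  have : p * ⟪d, x⟫_ℝ = (p * ⟪c, D ψ⟫_ℝ * (1 + β * ⟪c, x⟫_ℝ) * ρ ψ) / (2 * ρ ψ ^ 2) := by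
    rw [hdx]
    field_simp
  rw [this]
  exact div_nonneg hs (by positivity)

/-- **PROVED — cand-7's k-INDEPENDENCE TEST.** For every even eigenpair of the full block,
`A₀φ + β⟪c, φ⟫c = ε⁺φ`, and every odd eigenpair `Q⁻ψ = eψ`: `(ε⁺ − e)⟪φ, Dψ⟫ = 2ρ(ψ)⟪δ_a, φ⟫` — so
`(ε⁺_k − e)⟪φ_k, Dψ⟫/⟪δ_a, φ_k⟫` does not depend on `k` (DATA: to 3e-17 … 4e-28, AMP-IDENTITY.md §3). [folklore] -/
theorem intertwining_pairing_even_eigen (hA : ∀ v w : E, ⟪A₀ v, w⟫_ℝ = ⟪v, A₀ w⟫_ℝ)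
    (hG : GalerkinIntertwining A₀ c d β D Qm ρ) {e : ℝ} {ψ : F} (hψ : Qm ψ = e • ψ) {εp : ℝ} {φ : E}
    (hφ : A₀ φ + β • (⟪c, φ⟫_ℝ • c) = εp • φ) :
    (εp - e) * ⟪φ, D ψ⟫_ℝ = 2 * ρ ψ * ⟪d, φ⟫_ℝ := by
  have h := hG ψ
  rw [hψ, map_smul] at h
  have hAφ : A₀ φ = εp • φ - β • (⟪c, φ⟫_ℝ • c) := by rw [← hφ]; abel
  have key : ⟪A₀ (D ψ), φ⟫_ℝ = εp * ⟪φ, D ψ⟫_ℝ - β * (⟪c, φ⟫_ℝ * ⟪c, D ψ⟫_ℝ) := by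
    rw [hA, hAφ, inner_sub_right, real_inner_smul_right, real_inner_smul_right, real_inner_smul_right,
      real_inner_comm φ (D ψ), real_inner_comm c (D ψ)]
  have h2 := congrArg (fun v => ⟪v, φ⟫_ℝ) h
  simp only [inner_sub_left, inner_add_left, real_inner_smul_left] at h2
  rw [key, real_inner_comm φ (D ψ)] at h2
  linear_combination h2

end pairing

/-! ## §2 The odd-level wall on the AMP threshold -/

section wall

variable (A₀ : E →ₗ[ℝ] E) (c : E) (ev : ι → E → ℝ) (δ p ε₁ E₁ : ℝ)

/-- **PROVED — THE WALL, DIRECT FORM.** In the AMP setting (`ampFailureLevels`): if `e ∈ [ε₁, E₁]`, `x` solves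
`A₀ x − e x = c`, the edge evaluation `⟪δ_a, ·⟫` is among the evaluations, the floor is `δ ≥ 0` and
`p·⟪δ_a, x⟫ ≥ 0`, then the member `−2p·x` of the `u`-normalised AMP family at level `e` is not one-signed above
`δ` at the edge, so `e` is a failure level and `s* ≤ e`. [folklore] -/
theorem ampThreshold_le_of_edge_sign (h : ε₁ ≤ E₁) {e : ℝ} (he₁ : ε₁ ≤ e) (he₂ : e ≤ E₁) {x : E}
    (hx : A₀ x - e • x = c) {d : E} {i₀ : ι} (hev : ∀ v, ev i₀ v = ⟪d, v⟫_ℝ) (hδ : 0 ≤ δ)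
    (hsign : 0 ≤ p * ⟪d, x⟫_ℝ) : ampThreshold A₀ c ev δ p ε₁ E₁ ≤ e := by
  apply csInf_le (ampFailureLevels_bddBelow A₀ c ev δ p ε₁ E₁ h)
  refine Or.inl ⟨he₁, he₂, -((2 * p) • x), ?_, ?_⟩
  · have hv : -((2 * p) • x) = (-(2 * p)) • x := (neg_smul _ _).symm
    rw [hv, map_smul, smul_comm e (-(2 * p)) x, ← smul_sub, hx, neg_smul]
  · intro hall
    have hi := hall i₀
    rw [hev, inner_neg_right, real_inner_smul_right] at hi
    nlinarith

/-- **PROVED — THE WALL ON THE MARGIN**: under the same hypotheses `t* ≤ (e − ε₁)/(E₁ − ε₁)`. [folklore] -/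
theorem ampMargin_le_of_edge_sign (h : ε₁ < E₁) {e : ℝ} (he₁ : ε₁ ≤ e) (he₂ : e ≤ E₁) {x : E}
    (hx : A₀ x - e • x = c) {d : E} {i₀ : ι} (hev : ∀ v, ev i₀ v = ⟪d, v⟫_ℝ) (hδ : 0 ≤ δ)
    (hsign : 0 ≤ p * ⟪d, x⟫_ℝ) : ampMargin A₀ c ev δ p ε₁ E₁ ≤ (e - ε₁) / (E₁ - ε₁) := by
  have hthr := ampThreshold_le_of_edge_sign A₀ c ev δ p ε₁ E₁ h.le he₁ he₂ hx hev hδ hsign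
  unfold ampMargin
  exact div_le_div_of_nonneg_right (by linarith) (by linarith)

variable {A₀ c}

/-- **PROVED — THE ODD-LEVEL WALL FROM THREE SERVED SIGNS.** `A₀` symmetric, (G), an odd eigen-level
`e = ε₁⁻ ∈ [ε₁, E₁]` with eigenvector `ψ`, the AMP vector `x = x(ε₁⁻)`, `ρ(ψ) ≠ 0`, the edge evaluation among the
evaluations, floor `δ ≥ 0`, and `p·⟪c, Dψ⟫·(1 + β⟪c, x⟫)·ρ(ψ) ≥ 0` ⟹ `s* ≤ ε₁⁻`. [folklore] -/
theorem ampThreshold_le_oddLevel (hA : ∀ v w : E, ⟪A₀ v, w⟫_ℝ = ⟪v, A₀ w⟫_ℝ) {d : E} {β : ℝ}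
    {D : F →ₗ[ℝ] E} {Qm : F →ₗ[ℝ] F} {ρ : F →ₗ[ℝ] ℝ} (hG : GalerkinIntertwining A₀ c d β D Qm ρ)
    (h : ε₁ ≤ E₁) {e : ℝ} (he₁ : ε₁ ≤ e) (he₂ : e ≤ E₁) {ψ : F} (hψ : Qm ψ = e • ψ) {x : E}
    (hx : A₀ x - e • x = c) (hρ : ρ ψ ≠ 0) {i₀ : ι} (hev : ∀ v, ev i₀ v = ⟪d, v⟫_ℝ) (hδ : 0 ≤ δ)
    (hs : 0 ≤ p * ⟪c, D ψ⟫_ℝ * (1 + β * ⟪c, x⟫_ℝ) * ρ ψ) : ampThreshold A₀ c ev δ p ε₁ E₁ ≤ e :=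
  ampThreshold_le_of_edge_sign A₀ c ev δ p ε₁ E₁ h he₁ he₂ hx hev hδ (edge_sign_of_served hA hG hψ hx hρ hs)

/-- **PROVED — margin form of the odd-level wall**: `t* ≤ (ε₁⁻ − ε₁⁺)/(E₁ − ε₁⁺)`.  DATA (ζ, a = 1, N = 100):
wall `1.0324e-3`, measured `t* = 1.0104e-3` (97.9 % of the wall). [folklore] -/
theorem ampMargin_le_oddLevel (hA : ∀ v w : E, ⟪A₀ v, w⟫_ℝ = ⟪v, A₀ w⟫_ℝ) {d : E} {β : ℝ}
    {D : F →ₗ[ℝ] E} {Qm : F →ₗ[ℝ] F} {ρ : F →ₗ[ℝ] ℝ} (hG : GalerkinIntertwining A₀ c d β D Qm ρ)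
    (h : ε₁ < E₁) {e : ℝ} (he₁ : ε₁ ≤ e) (he₂ : e ≤ E₁) {ψ : F} (hψ : Qm ψ = e • ψ) {x : E}
    (hx : A₀ x - e • x = c) (hρ : ρ ψ ≠ 0) {i₀ : ι} (hev : ∀ v, ev i₀ v = ⟪d, v⟫_ℝ) (hδ : 0 ≤ δ)
    (hs : 0 ≤ p * ⟪c, D ψ⟫_ℝ * (1 + β * ⟪c, x⟫_ℝ) * ρ ψ) :
    ampMargin A₀ c ev δ p ε₁ E₁ ≤ (e - ε₁) / (E₁ - ε₁) :=
  ampMargin_le_of_edge_sign A₀ c ev δ p ε₁ E₁ h he₁ he₂ hx hev hδ (edge_sign_of_served hA hG hψ hx hρ hs)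

/-- **PROVED — THE AMP MARGIN IN LEVEL UNITS IS AT MOST THE EVEN–ODD GAP**: `(E₁ − ε₁⁺)·t* ≤ ε₁⁻ − ε₁⁺`
under the hypotheses of `ampMargin_le_oddLevel`; in particular a positive margin (⟺ a one-signed even ground
state, `ampMargin_pos_iff_oneSigned`) needs the odd level STRICTLY above the even bottom
(`oddLevel_gt_of_ampMargin_pos`). [folklore] -/
theorem gap_ge_ampMargin_mul (hA : ∀ v w : E, ⟪A₀ v, w⟫_ℝ = ⟪v, A₀ w⟫_ℝ) {d : E} {β : ℝ}
    {D : F →ₗ[ℝ] E} {Qm : F →ₗ[ℝ] F} {ρ : F →ₗ[ℝ] ℝ} (hG : GalerkinIntertwining A₀ c d β D Qm ρ)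
    (h : ε₁ < E₁) {e : ℝ} (he₁ : ε₁ ≤ e) (he₂ : e ≤ E₁) {ψ : F} (hψ : Qm ψ = e • ψ) {x : E}
    (hx : A₀ x - e • x = c) (hρ : ρ ψ ≠ 0) {i₀ : ι} (hev : ∀ v, ev i₀ v = ⟪d, v⟫_ℝ) (hδ : 0 ≤ δ)
    (hs : 0 ≤ p * ⟪c, D ψ⟫_ℝ * (1 + β * ⟪c, x⟫_ℝ) * ρ ψ) :
    (E₁ - ε₁) * ampMargin A₀ c ev δ p ε₁ E₁ ≤ e - ε₁ := by
  have hm := ampMargin_le_oddLevel ev δ p ε₁ E₁ hA hG h he₁ he₂ hψ hx hρ hev hδ hs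
  have hpos : 0 < E₁ - ε₁ := by linarith
  calc (E₁ - ε₁) * ampMargin A₀ c ev δ p ε₁ E₁ ≤ (E₁ - ε₁) * ((e - ε₁) / (E₁ - ε₁)) :=
        mul_le_mul_of_nonneg_left hm hpos.le
    _ = e - ε₁ := by field_simp

/-- **PROVED** — a positive AMP margin forces the odd level strictly above the even bottom (`ε₁ < ε₁⁻`), under
the hypotheses of `ampMargin_le_oddLevel`. [folklore] -/
theorem oddLevel_gt_of_ampMargin_pos (hA : ∀ v w : E, ⟪A₀ v, w⟫_ℝ = ⟪v, A₀ w⟫_ℝ) {d : E} {β : ℝ}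
    {D : F →ₗ[ℝ] E} {Qm : F →ₗ[ℝ] F} {ρ : F →ₗ[ℝ] ℝ} (hG : GalerkinIntertwining A₀ c d β D Qm ρ)
    (h : ε₁ < E₁) {e : ℝ} (he₁ : ε₁ ≤ e) (he₂ : e ≤ E₁) {ψ : F} (hψ : Qm ψ = e • ψ) {x : E}
    (hx : A₀ x - e • x = c) (hρ : ρ ψ ≠ 0) {i₀ : ι} (hev : ∀ v, ev i₀ v = ⟪d, v⟫_ℝ) (hδ : 0 ≤ δ)
    (hs : 0 ≤ p * ⟪c, D ψ⟫_ℝ * (1 + β * ⟪c, x⟫_ℝ) * ρ ψ)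
    (ht : 0 < ampMargin A₀ c ev δ p ε₁ E₁) : ε₁ < e := by
  have hg := gap_ge_ampMargin_mul ev δ p ε₁ E₁ hA hG h he₁ he₂ hψ hx hρ hev hδ hs
  have hpos : 0 < (E₁ - ε₁) * ampMargin A₀ c ev δ p ε₁ E₁ := mul_pos (by linarith) ht
  linarith

end wall

end Summit.RiemannHypothesis.RiemannHypothesis.Theorems.PolarPerronFrobenius
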